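import Literature.AlgebraicGeometry.Motives.HodgeTensor
import HarnessLib

/-!
# Discharged fact: the Mumford–Tate group of the Tate structure `ℚ(j)`, `j ≠ 0`

`Literature.AlgebraicGeometry.Motives.HodgeTensor` records as a named fact
(`Literature.HodgeStructure.mumfordTateGroup_tate : Prop`) the sanity check that, for `j ≠ 0`, the
Mumford–Tate group of the Tate Hodge structure `ℚ(j)` (weight `-2j`, type `(-j,-j)`), in the
stabiliser form `Literature.AlgebraicGeometry.Motives.HodgeStructure.mumfordTateGroup` (the subgroup of `GL(V)` — here its group
of `ℚ`-points `V ≃ₗ[ℚ] V` — fixing every rational tensor of weight `0` and type `(0,0)` in the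
tensor spaces `T^{a,b} V = V^{⊗a} ⊗ (V^∨)^{⊗b}`), is all of `GL₁(ℚ) = ℚˣ`:
`(tate j).mumfordTateGroup = ⊤`.  This is Deligne's `MT(ℚ(1)) = 𝔾ₘ` (*Hodge cycles on abelian
varieties*, LNM 900, I §3: the Mumford–Tate group is defined as the subgroup fixing all rational
tensors of type `(0,0)` in the spaces `T`, and Prop. 3.4 identifies it with the smallest
`ℚ`-subgroup `G` with `μ(𝔾ₘ) ⊂ G_ℂ`; on `ℚ(j) = ℚ(j)^{-j,-j}` one has `μ(λ) = λ^{j}`, whose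
image is all of `GL(ℚ(j)) = 𝔾ₘ` when `j ≠ 0`).  This file proves the fact
(`Literature.AlgebraicGeometry.Motives.HodgeStructure.mumfordTateGroup_tate_holds`), so the restatement
`Literature.Hodge.mumfordTateGroup_tate (h : HodgeStructure.mumfordTateGroup_tate)` of
`Literature.AlgebraicGeometry.Motives.HodgeStructures` can be fed `mumfordTateGroup_tate_holds`.

## Proof

For the vendored stabiliser definition the statement is pure multilinear algebra; no property of
the Hodge filtration of `ℚ(j)` beyond its weight is used, and the standing instance hypothesis
`[HodgeTensorFacts]` of the constructions is only carried, not used.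

* Since `ℚ(j)` has weight `-2j ≠ 0`, the weight-`0` condition `(a - b) · (-2j) = 0` on
  `T^{a,b} ℚ(j)` forces `a = b`.
* Every `g ∈ GL₁(ℚ)` is the homothety `c • id`, `c = g 1` (`linearEquiv_coe_eq_smul_id`), and the
  transpose of `g⁻¹` on `ℚ^∨` is the homothety of ratio `d = g⁻¹ 1` with `c d = 1`
  (`linearEquiv_symm_dualMap_eq_smul_id`).
* The tensor power of a homothety of ratio `c` on `r` factors is the homothety of ratio `c ^ r`
  (`piTensorProduct_map_smul_id`, from the multilinearity of `PiTensorProduct.map` in the family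
  of maps, Mathlib's `PiTensorProduct.mapMultilinear` and `MultilinearMap.map_smul_univ`).
* Hence `g` acts on `T^{a,a} ℚ = ℚ^{⊗a} ⊗ (ℚ^∨)^{⊗a}` by `c^a d^a = (c d)^a = 1`
  (`tensorSpaceAct_rat_eq_self`, via `Literature.AlgebraicGeometry.Motives.coe_tensorSpaceAct` and
  `TensorProduct.map_smul_left/right`), so it fixes in particular every Hodge tensor of type
  `(0,0)` there, i.e. lies in `MT(ℚ(j))(ℚ)` (`Literature.AlgebraicGeometry.Motives.HodgeStructure.mem_mumfordTateGroup_iff`).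

## References

* P. Deligne, *Hodge cycles on abelian varieties* (notes by J. S. Milne), in: Hodge Cycles,
  Motives, and Shimura Varieties, Lecture Notes in Mathematics 900, Springer (1982), 9–100;
  I §3, the definition of the Mumford–Tate group (paragraph preceding Prop. 3.4: "the subgroup of
  `GL(V) × 𝔾ₘ` fixing all rational tensors of type `(0,0)` belonging to any `T`") and
  Proposition 3.4 ("`G` is the smallest algebraic subgroup of `GL(V) × 𝔾ₘ` defined over `ℚ` for
  which `μ(𝔾ₘ) ⊂ G_ℂ`"). [Deligne1982HodgeCycles]
* B. Moonen, *An introduction to Mumford–Tate groups*, lecture notes (2004), §4, Key Property 4.5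
  (the stabiliser description inside `GL(V)` used by `Literature.AlgebraicGeometry.Motives.HodgeStructure.mumfordTateGroup`).
  [Moonen2004MT]
-/

open scoped TensorProduct PiTensorProduct

noncomputable section

namespace Literature.AlgebraicGeometry.Motives

/-- The tensor power of a homothety is a homothety: `⨂ᵢ (c • id) = c ^ #ι • id` on
`⨂[R] i : ι, M` (multilinearity of `PiTensorProduct.map` in the family of maps,
`PiTensorProduct.mapMultilinear`, and `MultilinearMap.map_smul_univ`). [folklore] -/
theorem piTensorProduct_map_smul_id {ι : Type*} [Fintype ι] (R : Type*) [CommSemiring R]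
    (M : Type*) [AddCommMonoid M] [Module R M] (c : R) :
    (PiTensorProduct.map fun _ : ι => c • (LinearMap.id : M →ₗ[R] M)) =
      c ^ Fintype.card ι • LinearMap.id := by
  have h := (PiTensorProduct.mapMultilinear R (fun _ : ι => M) (fun _ : ι => M)).map_smul_univ
    (fun _ => c) fun _ => LinearMap.id
  simp only [PiTensorProduct.mapMultilinear_apply, PiTensorProduct.map_id, Finset.prod_const,
    Finset.card_univ] at h
  exact h

/-- A linear automorphism of the line `R` (a commutative semiring) is the homothety of ratio its
value at `1`. [folklore] -/
theorem linearEquiv_coe_eq_smul_id {R : Type*} [CommSemiring R] (g : R ≃ₗ[R] R) :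
    (g : R →ₗ[R] R) = g 1 • LinearMap.id :=
  LinearMap.ext_ring (by simp)

/-- The transpose of `g⁻¹` on the dual line `R^∨`, for `g ∈ GL₁(R)` (`R` a commutative semiring),
is the homothety of ratio `g⁻¹ 1`. [folklore] -/
theorem linearEquiv_symm_dualMap_eq_smul_id {R : Type*} [CommSemiring R] (g : R ≃ₗ[R] R) :
    (g.symm.dualMap : Module.Dual R R →ₗ[R] Module.Dual R R) = g.symm 1 • LinearMap.id := by
  refine LinearMap.ext fun φ => LinearMap.ext_ring ?_
  have hφ : φ (g.symm 1) = g.symm 1 * φ 1 := by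
    conv_lhs => rw [← mul_one (g.symm 1), ← smul_eq_mul, map_smul, smul_eq_mul]
  simpa using hφ

/-- On the line `V = ℚ`, every `g ∈ GL₁(ℚ) = ℚˣ` acts trivially on the balanced tensor spaces
`T^{a,a} ℚ = ℚ^{⊗a} ⊗ (ℚ^∨)^{⊗a}`: with `c = g 1`, `d = g⁻¹ 1` one has `g = c • id`,
`(g⁻¹)^∨ = d • id`, `c d = 1`, and `g^{⊗a} ⊗ ((g⁻¹)^∨)^{⊗a} = (c d)^a • id = id`
(Deligne, LNM 900, I §3: the factorwise action of `GL(V)` on `T = V^{⊗m₁} ⊗ (V^∨)^{⊗m₂}`, here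
with `GL(V) = 𝔾ₘ`). [folklore] -/
theorem tensorSpaceAct_rat_eq_self {a : ℕ} (g : ℚ ≃ₗ[ℚ] ℚ) (t : hodgeTensorSpace ℚ a a) :
    tensorSpaceAct g t = t := by
  have hcd : g 1 * g.symm 1 = 1 := by
    have h := g.apply_symm_apply 1
    rw [← mul_one (g.symm 1), ← smul_eq_mul, map_smul, smul_eq_mul] at h
    rwa [mul_comm]
  have key : (tensorSpaceAct (a := a) (b := a) g :
      hodgeTensorSpace ℚ a a →ₗ[ℚ] hodgeTensorSpace ℚ a a) = LinearMap.id := by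
    rw [coe_tensorSpaceAct, linearEquiv_coe_eq_smul_id, linearEquiv_symm_dualMap_eq_smul_id,
      piTensorProduct_map_smul_id, piTensorProduct_map_smul_id, TensorProduct.map_smul_left,
      TensorProduct.map_smul_right, TensorProduct.map_id, smul_smul, Fintype.card_fin, ← mul_pow,
      hcd, one_pow, one_smul]
  simpa using LinearMap.congr_fun key t

namespace HodgeStructure

/-- **Discharge of the named fact `mumfordTateGroup_tate`**: for `j ≠ 0` the Mumford–Tate group
(`ℚ`-points, stabiliser form) of the Tate structure `ℚ(j)` is all of `GL₁(ℚ) = ℚˣ`.  Since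
`ℚ(j)` has weight `-2j ≠ 0`, the weight-`0` tensor spaces `T^{a,b} ℚ(j)` (`(a - b)(-2j) = 0`)
are the balanced ones `a = b`, and on `T^{a,a} ℚ` every `g ∈ GL₁(ℚ)` acts as the identity
(`tensorSpaceAct_rat_eq_self`), so in particular fixes every rational tensor of type `(0,0)`.
This is Deligne's `MT(ℚ(1)) = 𝔾ₘ`: the Mumford–Tate group is the subgroup fixing the rational
tensors of type `(0,0)`, and (Prop. 3.4) the smallest `ℚ`-subgroup `G` with `μ(𝔾ₘ) ⊂ G_ℂ`;
for `V = ℚ(j) = V^{-j,-j}`, `j ≠ 0`, `μ(λ) = λ^{j}` maps onto `GL(V) = 𝔾ₘ`.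
[cite: Deligne1982HodgeCycles, I §3, definition of the Mumford–Tate group and Prop. 3.4] -/
theorem mumfordTateGroup_tate_holds : mumfordTateGroup_tate := by
  intro _ j hj
  refine eq_top_iff.2 fun g _ => (mem_mumfordTateGroup_iff _ g).2 fun a b hab t _ => ?_
  obtain rfl : a = b := by
    have h2j : (-2 * j : ℤ) ≠ 0 := by omega
    have hab' := (mul_eq_zero.1 hab).resolve_right h2j
    omega
  exact tensorSpaceAct_rat_eq_self g t

end HodgeStructure

end Literature.AlgebraicGeometry.Motives

end
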